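import Literature.IUT.HodgeArakelov.LocalTriMuDataIso

/-!
# [IUTchII] Def 4.9 (v)–(vii): isomorphisms of the ARCHIMEDEAN local data and of the local data by type of place

Owner file (abc-iut cell, layer L6; abc-iut-L6-t2), sequel to `LocalTriMuDataIso.lean`. S. Mochizuki,
*Inter-universal Teichmüller theory II*, kurims Dec-2020 manuscript, Def 4.9 (v) p. 157 (archimedean local data:
the monoid of `‡F^⊢_w`, its splitting, and "a sort of Kummer structure": compatible surjections
`(‡D^⊢_w)^× ↠ O^{×μ_N}(A)`), (vi) (local data by type (a) bad / (b) good nonarchimedean / (c) archimedean),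
(vii) p. 158 ("a morphism … is defined to be a collection of isomorphisms, indexed by `V`, between the various
constituent objects"). This file defines:

* `unitsModRootsMap e N : O^{×μ_N}(A) → O^{×μ_N}(A')` induced by a monoid isomorphism `e : O ⥲ O'`;
* `ArchTriMuDatum.Iso D D'` — `e : O^▷ ⥲ O'^▷` carrying the splitting, with `c : (‡D^⊢_w)^× ⥲ (‡D'^⊢_w)^×` compatible
  with the Kummer projections (`proj' N (c z) = unitsModRootsMap e N (proj N z)`); `ArchTriMuDatum.MuIso` (the
  same without the splitting: the `F^{⊢×μ}` datum at an archimedean place); `refl`/`symm`/`trans`, `toMuIso`;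
* `LocalTriMuDatum.Iso` / `LocalTriMuDatum.MuIso` by type of place, with `refl`/`symm`/`trans` and the groupoid
  laws — the per-place morphisms of `F^{⊢▶×μ}`- and `F^{⊢×μ}`-prime-strips (Def 4.9 (vii)).

Claim key `Mochizuki2012` DISPUTED (D-0012): definitions + bookkeeping over interfaces; nothing asserted.
-/

namespace Literature.IUT.HodgeArakelov

universe u v w

/-! ### 0. `O^{×μ_N}` is functorial in monoid isomorphisms -/

section UnitsModRootsMap

variable {O O' O'' : Type v} [CommMonoid O] [CommMonoid O'] [CommMonoid O'']

/-- Roots of unity map to roots of unity under `Units.mapEquiv`. (bookkeeping). [cite: Mochizuki2012, Def 4.9 (vii) p.158] -/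
theorem rootsOfUnity_le_comap_mapEquiv (e : O ≃* O') (N : ℕ) :
    rootsOfUnity N O ≤ (rootsOfUnity N O').comap (Units.mapEquiv e).toMonoidHom := by
  intro ζ hζ
  rw [Subgroup.mem_comap, mem_rootsOfUnity]
  rw [mem_rootsOfUnity] at hζ
  change (Units.mapEquiv e) ζ ^ N = 1
  rw [← map_pow, hζ, map_one]

/-- The homomorphism `O^{×μ_N}(A) → O^{×μ_N}(A')` induced by a monoid isomorphism `O^▷(A) ⥲ O^▷(A')` ([IUTchII] Def
4.9 (i)/(v): `O^{×μ_N} := O^×/μ_N`). [cite: Mochizuki2012, Def 4.9 (v) p.157] -/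
def unitsModRootsMap (e : O ≃* O') (N : ℕ) : UnitsModRoots O N →* UnitsModRoots O' N :=
  QuotientGroup.map _ _ (Units.mapEquiv e).toMonoidHom (rootsOfUnity_le_comap_mapEquiv e N)

/-- On classes: `[u] ↦ [e u]`. (bookkeeping). [cite: Mochizuki2012, Def 4.9 (vii) p.158] -/
@[simp] theorem unitsModRootsMap_mk (e : O ≃* O') (N : ℕ) (u : Oˣ) :
    unitsModRootsMap e N (QuotientGroup.mk u) = QuotientGroup.mk (Units.mapEquiv e u) := rfl

/-- Functoriality: identity. (bookkeeping). [cite: Mochizuki2012, Def 4.9 (vii) p.158] -/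
theorem unitsModRootsMap_refl (N : ℕ) (x : UnitsModRoots O N) :
    unitsModRootsMap (MulEquiv.refl O) N x = x := by
  induction x using QuotientGroup.induction_on with
  | H u => rw [unitsModRootsMap_mk]; rfl

/-- Functoriality: composition. (bookkeeping). [cite: Mochizuki2012, Def 4.9 (vii) p.158] -/
theorem unitsModRootsMap_trans (e : O ≃* O') (e' : O' ≃* O'') (N : ℕ) (x : UnitsModRoots O N) :
    unitsModRootsMap (e.trans e') N x = unitsModRootsMap e' N (unitsModRootsMap e N x) := by
  induction x using QuotientGroup.induction_on with
  | H u => simp only [unitsModRootsMap_mk]; rfl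

/-- Functoriality: `e.symm` undoes `e`. (bookkeeping). [cite: Mochizuki2012, Def 4.9 (vii) p.158] -/
theorem unitsModRootsMap_symm_apply (e : O ≃* O') (N : ℕ) (x : UnitsModRoots O N) :
    unitsModRootsMap e.symm N (unitsModRootsMap e N x) = x := by
  rw [← unitsModRootsMap_trans]
  induction x using QuotientGroup.induction_on with
  | H u =>
    rw [unitsModRootsMap_mk]
    congr 1
    ext
    simp

/-- Functoriality: `e` undoes `e.symm`. (bookkeeping). [cite: Mochizuki2012, Def 4.9 (vii) p.158] -/
theorem unitsModRootsMap_apply_symm (e : O ≃* O') (N : ℕ) (y : UnitsModRoots O' N) :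
    unitsModRootsMap e N (unitsModRootsMap e.symm N y) = y := by
  rw [← unitsModRootsMap_trans]
  induction y using QuotientGroup.induction_on with
  | H u =>
    rw [unitsModRootsMap_mk]
    congr 1
    ext
    simp

end UnitsModRootsMap

/-! ### 1. Archimedean local data (Def 4.9 (v)): isomorphisms -/

namespace ArchTriMuDatum

/-- **An isomorphism of archimedean local data `‡F^{⊢▶×μ}_w ⥲ ‡F'^{⊢▶×μ}_w`** ([IUTchII] Def 4.9 (v), (vii)): an
isomorphism `e` of the monoids `O^▷` carrying the splitting onto the splitting, together with an isomorphism `c`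
of the circles `(‡D^⊢_w)^×` compatible with the Kummer projections `(‡D^⊢_w)^× ↠ O^{×μ_N}`.
[cite: Mochizuki2012, Def 4.9 (vii) p.158] -/
structure Iso (D D' : ArchTriMuDatum.{v}) : Type v where
  /-- the isomorphism of monoids -/
  e : D.O ≃* D'.O
  /-- it carries the splitting onto the splitting -/
  map_splitting : D.splitting.map e.toMonoidHom = D'.splitting
  /-- the isomorphism of the circles `(‡D^⊢_w)^×` -/
  c : D.kummer.circle ≃* D'.kummer.circle
  /-- compatibility with the Kummer projections -/
  map_proj : ∀ (N : ℕ) (z : D.kummer.circle), D'.kummer.proj N (c z) = unitsModRootsMap e N (D.kummer.proj N z)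

/-- **An isomorphism of the archimedean `×μ`-data** (the `F^{⊢×μ}` datum at `v ∈ V^arc`, Def 4.9 (vi)–(vii)): as
`Iso` but without the splitting. [cite: Mochizuki2012, Def 4.9 (vii) p.158] -/
structure MuIso (D D' : ArchTriMuDatum.{v}) : Type v where
  /-- the isomorphism of monoids -/
  e : D.O ≃* D'.O
  /-- the isomorphism of the circles -/
  c : D.kummer.circle ≃* D'.kummer.circle
  /-- compatibility with the Kummer projections -/
  map_proj : ∀ (N : ℕ) (z : D.kummer.circle), D'.kummer.proj N (c z) = unitsModRootsMap e N (D.kummer.proj N z)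

variable {D D' D'' : ArchTriMuDatum.{v}}

/-- Extensionality for `Iso`. (bookkeeping). [cite: Mochizuki2012, Def 4.9 (vii) p.158] -/
theorem Iso.ext' {f f' : Iso D D'} (he : f.e = f'.e) (hc : f.c = f'.c) : f = f' := by
  cases f; cases f'; cases he; cases hc; rfl

/-- Extensionality for `MuIso`. (bookkeeping). [cite: Mochizuki2012, Def 4.9 (vii) p.158] -/
theorem MuIso.ext' {f f' : MuIso D D'} (he : f.e = f'.e) (hc : f.c = f'.c) : f = f' := by
  cases f; cases f'; cases he; cases hc; rfl

/-- Identity. [cite: Mochizuki2012, Def 4.9 (vii) p.158] -/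
def Iso.refl (D : ArchTriMuDatum.{v}) : Iso D D where
  e := MulEquiv.refl _
  map_splitting := by ext x; simp
  c := MulEquiv.refl _
  map_proj N z := by rw [unitsModRootsMap_refl]; rfl

/-- Composite. [cite: Mochizuki2012, Def 4.9 (vii) p.158] -/
def Iso.trans (f : Iso D D') (f' : Iso D' D'') : Iso D D'' where
  e := f.e.trans f'.e
  map_splitting := by
    have : (f.e.trans f'.e).toMonoidHom = f'.e.toMonoidHom.comp f.e.toMonoidHom := rfl
    rw [this, ← Submonoid.map_map, f.map_splitting, f'.map_splitting]
  c := f.c.trans f'.c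
  map_proj N z := by
    rw [MulEquiv.trans_apply, f'.map_proj, f.map_proj, unitsModRootsMap_trans]

/-- Inverse. [cite: Mochizuki2012, Def 4.9 (vii) p.158] -/
def Iso.symm (f : Iso D D') : Iso D' D where
  e := f.e.symm
  map_splitting := by
    rw [← f.map_splitting, Submonoid.map_map]
    have : f.e.symm.toMonoidHom.comp f.e.toMonoidHom = MonoidHom.id _ := by ext x; simp
    rw [this, Submonoid.map_id]
  c := f.c.symm
  map_proj N z' := by
    have h := f.map_proj N (f.c.symm z')
    rw [MulEquiv.apply_symm_apply] at h
    rw [h, unitsModRootsMap_symm_apply]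

/-- Identity (`×μ`). [cite: Mochizuki2012, Def 4.9 (vii) p.158] -/
def MuIso.refl (D : ArchTriMuDatum.{v}) : MuIso D D where
  e := MulEquiv.refl _
  c := MulEquiv.refl _
  map_proj N z := by rw [unitsModRootsMap_refl]; rfl

/-- Composite (`×μ`). [cite: Mochizuki2012, Def 4.9 (vii) p.158] -/
def MuIso.trans (f : MuIso D D') (f' : MuIso D' D'') : MuIso D D'' where
  e := f.e.trans f'.e
  c := f.c.trans f'.c
  map_proj N z := by rw [MulEquiv.trans_apply, f'.map_proj, f.map_proj, unitsModRootsMap_trans]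

/-- Inverse (`×μ`). [cite: Mochizuki2012, Def 4.9 (vii) p.158] -/
def MuIso.symm (f : MuIso D D') : MuIso D' D where
  e := f.e.symm
  c := f.c.symm
  map_proj N z' := by
    have h := f.map_proj N (f.c.symm z')
    rw [MulEquiv.apply_symm_apply] at h
    rw [h, unitsModRootsMap_symm_apply]

/-- "Passing to the `F^{⊢×μ}` datum": forget the splitting. [cite: Mochizuki2012, Def 4.9 (vii) p.158] -/
def Iso.toMuIso (f : Iso D D') : MuIso D D' := ⟨f.e, f.c, f.map_proj⟩

/-- Groupoid laws for `Iso`: `refl ≫ f`, `f ≫ refl`, associativity, inverses. (bookkeeping). [cite: Mochizuki2012, Def 4.9 (vii) p.158] -/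
theorem Iso.refl_trans (f : Iso D D') : (Iso.refl D).trans f = f :=
  Iso.ext' (MulEquiv.ext fun _ => rfl) (MulEquiv.ext fun _ => rfl)

/-- `f ≫ refl = f`. (bookkeeping). [cite: Mochizuki2012, Def 4.9 (vii) p.158] -/
theorem Iso.trans_refl (f : Iso D D') : f.trans (Iso.refl D') = f :=
  Iso.ext' (MulEquiv.ext fun _ => rfl) (MulEquiv.ext fun _ => rfl)

/-- Associativity. (bookkeeping). [cite: Mochizuki2012, Def 4.9 (vii) p.158] -/
theorem Iso.trans_assoc {D''' : ArchTriMuDatum.{v}} (f : Iso D D') (f' : Iso D' D'') (f'' : Iso D'' D''') :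
    (f.trans f').trans f'' = f.trans (f'.trans f'') :=
  Iso.ext' (MulEquiv.ext fun _ => rfl) (MulEquiv.ext fun _ => rfl)

/-- `f ≫ f⁻¹ = refl`. (bookkeeping). [cite: Mochizuki2012, Def 4.9 (vii) p.158] -/
theorem Iso.trans_symm (f : Iso D D') : f.trans f.symm = Iso.refl D :=
  Iso.ext' (MulEquiv.ext fun x => by simp [Iso.trans, Iso.symm, Iso.refl])
    (MulEquiv.ext fun x => by simp [Iso.trans, Iso.symm, Iso.refl])

/-- `f⁻¹ ≫ f = refl`. (bookkeeping). [cite: Mochizuki2012, Def 4.9 (vii) p.158] -/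
theorem Iso.symm_trans (f : Iso D D') : f.symm.trans f = Iso.refl D' :=
  Iso.ext' (MulEquiv.ext fun x => by simp [Iso.trans, Iso.symm, Iso.refl])
    (MulEquiv.ext fun x => by simp [Iso.trans, Iso.symm, Iso.refl])

/-- Groupoid laws for `MuIso`. (bookkeeping). [cite: Mochizuki2012, Def 4.9 (vii) p.158] -/
theorem MuIso.refl_trans (f : MuIso D D') : (MuIso.refl D).trans f = f :=
  MuIso.ext' (MulEquiv.ext fun _ => rfl) (MulEquiv.ext fun _ => rfl)

/-- `f ≫ refl = f` (`×μ`). (bookkeeping). [cite: Mochizuki2012, Def 4.9 (vii) p.158] -/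
theorem MuIso.trans_refl (f : MuIso D D') : f.trans (MuIso.refl D') = f :=
  MuIso.ext' (MulEquiv.ext fun _ => rfl) (MulEquiv.ext fun _ => rfl)

/-- Associativity (`×μ`). (bookkeeping). [cite: Mochizuki2012, Def 4.9 (vii) p.158] -/
theorem MuIso.trans_assoc {D''' : ArchTriMuDatum.{v}} (f : MuIso D D') (f' : MuIso D' D'') (f'' : MuIso D'' D''') :
    (f.trans f').trans f'' = f.trans (f'.trans f'') :=
  MuIso.ext' (MulEquiv.ext fun _ => rfl) (MulEquiv.ext fun _ => rfl)

/-- `f ≫ f⁻¹ = refl` (`×μ`). (bookkeeping). [cite: Mochizuki2012, Def 4.9 (vii) p.158] -/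
theorem MuIso.trans_symm (f : MuIso D D') : f.trans f.symm = MuIso.refl D :=
  MuIso.ext' (MulEquiv.ext fun x => by simp [MuIso.trans, MuIso.symm, MuIso.refl])
    (MulEquiv.ext fun x => by simp [MuIso.trans, MuIso.symm, MuIso.refl])

/-- `f⁻¹ ≫ f = refl` (`×μ`). (bookkeeping). [cite: Mochizuki2012, Def 4.9 (vii) p.158] -/
theorem MuIso.symm_trans (f : MuIso D D') : f.symm.trans f = MuIso.refl D' :=
  MuIso.ext' (MulEquiv.ext fun x => by simp [MuIso.trans, MuIso.symm, MuIso.refl])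
    (MulEquiv.ext fun x => by simp [MuIso.trans, MuIso.symm, MuIso.refl])

/-- `toMuIso` respects identities. (bookkeeping). [cite: Mochizuki2012, Def 4.9 (vii) p.158] -/
theorem Iso.toMuIso_refl (D : ArchTriMuDatum.{v}) : (Iso.refl D).toMuIso = MuIso.refl D := rfl

/-- `toMuIso` respects composition. (bookkeeping). [cite: Mochizuki2012, Def 4.9 (vii) p.158] -/
theorem Iso.toMuIso_trans (f : Iso D D') (f' : Iso D' D'') : (f.trans f').toMuIso = f.toMuIso.trans f'.toMuIso := rfl

end ArchTriMuDatum

/-! ### 2. Local data by type of place (Def 4.9 (vi)): isomorphisms -/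

namespace LocalTriMuDatum

variable {l : ℕ} {G : Type u} [Group G] {X : GroupTheoreticUnits.{u, w} G}

/-- **An isomorphism of local data `‡F^{⊢▶×μ}_v ⥲ ‡F'^{⊢▶×μ}_v`** by type of place ([IUTchII] Def 4.9 (vi)–(vii)):
the nonarchimedean `Iso` at bad and good places, the archimedean `Iso` (lifted to a common universe) at
archimedean places. [cite: Mochizuki2012, Def 4.9 (vii) p.158] -/
def Iso : {k : PlaceKind} → LocalTriMuDatum.{u, v, w} l G X k → LocalTriMuDatum.{u, v, w} l G X k →
    Type (max u v w)
  | _, .bad D, .bad D' => NonarchTriMuDatum.Iso D D'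
  | _, .good D, .good D' => NonarchTriMuDatum.Iso D D'
  | _, .arch D, .arch D' => ULift.{max u w} (ArchTriMuDatum.Iso D D')

/-- **An isomorphism of the `×μ`-data** (`F^{⊢×μ}`-prime-strip morphisms at one place, Def 4.9 (vi)–(vii)), by
type of place. [cite: Mochizuki2012, Def 4.9 (vii) p.158] -/
def MuIso : {k : PlaceKind} → LocalTriMuDatum.{u, v, w} l G X k → LocalTriMuDatum.{u, v, w} l G X k →
    Type (max u v w)
  | _, .bad D, .bad D' => NonarchTriMuDatum.MuIso D D'
  | _, .good D, .good D' => NonarchTriMuDatum.MuIso D D'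
  | _, .arch D, .arch D' => ULift.{max u w} (ArchTriMuDatum.MuIso D D')

/-- Identity. [cite: Mochizuki2012, Def 4.9 (vii) p.158] -/
def Iso.refl : {k : PlaceKind} → (D : LocalTriMuDatum.{u, v, w} l G X k) → Iso D D
  | _, .bad D => NonarchTriMuDatum.Iso.refl D
  | _, .good D => NonarchTriMuDatum.Iso.refl D
  | _, .arch D => ⟨ArchTriMuDatum.Iso.refl D⟩

/-- Composite. [cite: Mochizuki2012, Def 4.9 (vii) p.158] -/
def Iso.trans : {k : PlaceKind} → {D D' D'' : LocalTriMuDatum.{u, v, w} l G X k} →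
    Iso D D' → Iso D' D'' → Iso D D''
  | _, .bad _, .bad _, .bad _, f, f' => NonarchTriMuDatum.Iso.trans f f'
  | _, .good _, .good _, .good _, f, f' => NonarchTriMuDatum.Iso.trans f f'
  | _, .arch _, .arch _, .arch _, f, f' => ⟨ArchTriMuDatum.Iso.trans f.down f'.down⟩

/-- Inverse. [cite: Mochizuki2012, Def 4.9 (vii) p.158] -/
def Iso.symm : {k : PlaceKind} → {D D' : LocalTriMuDatum.{u, v, w} l G X k} → Iso D D' → Iso D' D
  | _, .bad _, .bad _, f => NonarchTriMuDatum.Iso.symm f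
  | _, .good _, .good _, f => NonarchTriMuDatum.Iso.symm f
  | _, .arch _, .arch _, f => ⟨ArchTriMuDatum.Iso.symm f.down⟩

/-- Identity (`×μ`). [cite: Mochizuki2012, Def 4.9 (vii) p.158] -/
def MuIso.refl : {k : PlaceKind} → (D : LocalTriMuDatum.{u, v, w} l G X k) → MuIso D D
  | _, .bad D => NonarchTriMuDatum.MuIso.refl D
  | _, .good D => NonarchTriMuDatum.MuIso.refl D
  | _, .arch D => ⟨ArchTriMuDatum.MuIso.refl D⟩

/-- Composite (`×μ`). [cite: Mochizuki2012, Def 4.9 (vii) p.158] -/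
def MuIso.trans : {k : PlaceKind} → {D D' D'' : LocalTriMuDatum.{u, v, w} l G X k} →
    MuIso D D' → MuIso D' D'' → MuIso D D''
  | _, .bad _, .bad _, .bad _, f, f' => NonarchTriMuDatum.MuIso.trans f f'
  | _, .good _, .good _, .good _, f, f' => NonarchTriMuDatum.MuIso.trans f f'
  | _, .arch _, .arch _, .arch _, f, f' => ⟨ArchTriMuDatum.MuIso.trans f.down f'.down⟩

/-- Inverse (`×μ`). [cite: Mochizuki2012, Def 4.9 (vii) p.158] -/
def MuIso.symm : {k : PlaceKind} → {D D' : LocalTriMuDatum.{u, v, w} l G X k} → MuIso D D' → MuIso D' D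
  | _, .bad _, .bad _, f => NonarchTriMuDatum.MuIso.symm f
  | _, .good _, .good _, f => NonarchTriMuDatum.MuIso.symm f
  | _, .arch _, .arch _, f => ⟨ArchTriMuDatum.MuIso.symm f.down⟩

/-- "Passing to the `F^{⊢×μ}` datum" on isomorphisms (Def 4.9 (vi)–(vii)), by type of place.
[cite: Mochizuki2012, Def 4.9 (vii) p.158] -/
def Iso.toMuIso : {k : PlaceKind} → {D D' : LocalTriMuDatum.{u, v, w} l G X k} → Iso D D' → MuIso D D'
  | _, .bad _, .bad _, f => NonarchTriMuDatum.Iso.toMuIso f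
  | _, .good _, .good _, f => NonarchTriMuDatum.Iso.toMuIso f
  | _, .arch _, .arch _, f => ⟨ArchTriMuDatum.Iso.toMuIso f.down⟩

variable {k : PlaceKind} {D D' D'' D''' : LocalTriMuDatum.{u, v, w} l G X k}

/-- `refl ≫ f = f`. (bookkeeping). [cite: Mochizuki2012, Def 4.9 (vii) p.158] -/
theorem Iso.refl_trans (f : Iso D D') : (Iso.refl D).trans f = f := by
  cases D <;> cases D' <;> first
    | exact NonarchTriMuDatum.Iso.refl_trans f
    | exact congrArg ULift.up (ArchTriMuDatum.Iso.refl_trans f.down)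

/-- `f ≫ refl = f`. (bookkeeping). [cite: Mochizuki2012, Def 4.9 (vii) p.158] -/
theorem Iso.trans_refl (f : Iso D D') : f.trans (Iso.refl D') = f := by
  cases D <;> cases D' <;> first
    | exact NonarchTriMuDatum.Iso.trans_refl f
    | exact congrArg ULift.up (ArchTriMuDatum.Iso.trans_refl f.down)

/-- Associativity. (bookkeeping). [cite: Mochizuki2012, Def 4.9 (vii) p.158] -/
theorem Iso.trans_assoc (f : Iso D D') (f' : Iso D' D'') (f'' : Iso D'' D''') :
    (f.trans f').trans f'' = f.trans (f'.trans f'') := by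
  cases D <;> cases D' <;> cases D'' <;> cases D''' <;> first
    | exact NonarchTriMuDatum.Iso.trans_assoc f f' f''
    | exact congrArg ULift.up (ArchTriMuDatum.Iso.trans_assoc f.down f'.down f''.down)

/-- `f ≫ f⁻¹ = refl`. (bookkeeping). [cite: Mochizuki2012, Def 4.9 (vii) p.158] -/
theorem Iso.trans_symm (f : Iso D D') : f.trans f.symm = Iso.refl D := by
  cases D <;> cases D' <;> first
    | exact NonarchTriMuDatum.Iso.trans_symm f
    | exact congrArg ULift.up (ArchTriMuDatum.Iso.trans_symm f.down)

/-- `f⁻¹ ≫ f = refl`. (bookkeeping). [cite: Mochizuki2012, Def 4.9 (vii) p.158] -/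
theorem Iso.symm_trans (f : Iso D D') : f.symm.trans f = Iso.refl D' := by
  cases D <;> cases D' <;> first
    | exact NonarchTriMuDatum.Iso.symm_trans f
    | exact congrArg ULift.up (ArchTriMuDatum.Iso.symm_trans f.down)

/-- `refl ≫ f = f` (`×μ`). (bookkeeping). [cite: Mochizuki2012, Def 4.9 (vii) p.158] -/
theorem MuIso.refl_trans (f : MuIso D D') : (MuIso.refl D).trans f = f := by
  cases D <;> cases D' <;> first
    | exact NonarchTriMuDatum.MuIso.refl_trans f
    | exact congrArg ULift.up (ArchTriMuDatum.MuIso.refl_trans f.down)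

/-- `f ≫ refl = f` (`×μ`). (bookkeeping). [cite: Mochizuki2012, Def 4.9 (vii) p.158] -/
theorem MuIso.trans_refl (f : MuIso D D') : f.trans (MuIso.refl D') = f := by
  cases D <;> cases D' <;> first
    | exact NonarchTriMuDatum.MuIso.trans_refl f
    | exact congrArg ULift.up (ArchTriMuDatum.MuIso.trans_refl f.down)

/-- Associativity (`×μ`). (bookkeeping). [cite: Mochizuki2012, Def 4.9 (vii) p.158] -/
theorem MuIso.trans_assoc (f : MuIso D D') (f' : MuIso D' D'') (f'' : MuIso D'' D''') :
    (f.trans f').trans f'' = f.trans (f'.trans f'') := by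
  cases D <;> cases D' <;> cases D'' <;> cases D''' <;> first
    | exact NonarchTriMuDatum.MuIso.trans_assoc f f' f''
    | exact congrArg ULift.up (ArchTriMuDatum.MuIso.trans_assoc f.down f'.down f''.down)

/-- `f ≫ f⁻¹ = refl` (`×μ`). (bookkeeping). [cite: Mochizuki2012, Def 4.9 (vii) p.158] -/
theorem MuIso.trans_symm (f : MuIso D D') : f.trans f.symm = MuIso.refl D := by
  cases D <;> cases D' <;> first
    | exact NonarchTriMuDatum.MuIso.trans_symm f
    | exact congrArg ULift.up (ArchTriMuDatum.MuIso.trans_symm f.down)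

/-- `f⁻¹ ≫ f = refl` (`×μ`). (bookkeeping). [cite: Mochizuki2012, Def 4.9 (vii) p.158] -/
theorem MuIso.symm_trans (f : MuIso D D') : f.symm.trans f = MuIso.refl D' := by
  cases D <;> cases D' <;> first
    | exact NonarchTriMuDatum.MuIso.symm_trans f
    | exact congrArg ULift.up (ArchTriMuDatum.MuIso.symm_trans f.down)

/-- `toMuIso` respects identities. (bookkeeping). [cite: Mochizuki2012, Def 4.9 (vii) p.158] -/
theorem Iso.toMuIso_refl (D : LocalTriMuDatum.{u, v, w} l G X k) : (Iso.refl D).toMuIso = MuIso.refl D := by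
  cases D <;> first
    | exact NonarchTriMuDatum.Iso.toMuIso_refl _
    | rfl

/-- `toMuIso` respects composition. (bookkeeping). [cite: Mochizuki2012, Def 4.9 (vii) p.158] -/
theorem Iso.toMuIso_trans (f : Iso D D') (f' : Iso D' D'') :
    (f.trans f').toMuIso = f.toMuIso.trans f'.toMuIso := by
  cases D <;> cases D' <;> cases D'' <;> first
    | exact NonarchTriMuDatum.Iso.toMuIso_trans f f'
    | rfl

end LocalTriMuDatum

end Literature.IUT.HodgeArakelov
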